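import Mathlib
import HarnessLib
import Summits.HubbardSuperconductivity.HubbardSuperconductivity.Theorems.KLProgrammeKLRegimeEngineLastStepResponseBracketFlowSharpCore
import Summits.HubbardSuperconductivity.HubbardSuperconductivity.Theorems.KLProgrammeKLRegimeTwoVolumeLastScaleFrameExact

/-!
# K3 gen-8-FLOW (stmt 20437, stub (C), located item #20, cure (δ′) «LAST-STEP SWAP», layer F3f): THE RESPONSE BRACKET AT THE FLOW FRAMES, SHARP —
# `lastResponse_bracket_flow_sharp`: as `lastResponse_bracket_flow` with the datum-`1` Bell rows DISCHARGED (`PP_a j := P₄·4^{jm}`, `Za := P₄`) and the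
# tangential constant at its natural size `Zt ≥ 128·ΣGfr·P₄`, `P₄ = 231⁴ + 6·231²·7·10⁵ + 3·(7·10⁵)² + 925·D = 1696963596321 + 925·D`, `D = 10¹⁴(1 + Gfr₃ + Gfr₄)`

Cell gate-hubbard-kl, seat p2 g17.  `…ResponseBracketFlow` (F3d) booked the curve's low jets against the order-4 size `D ≈ 10¹⁴` (so `Zt ∝ D⁴`, and `Zt³` sits in
the threshold).  With `…ResponseInputsSharp` (`lastResponse_tjets_of_pieceJets_sharp`, `datumOne_bellRows_sharp`) the low orders keep `klCurveD1 ≤ 231`,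
`klCurveD2 ≤ 7·10⁵`: `Zt ≥ 128·ΣGfr·P₄` (`≈ 1.2·10¹⁹·ΣGfr·(1+Gfr₃+Gfr₄)`), the `R_a` Bell rows are discharged against `P₄·4^{jm}`, and the smallness reads
`2·Zt·U ≤ 1`, `16·C·U ≤ 1`, `C = 2²⁹·(1/32)·Zt³·P₄ + 2³⁸·Zt²·Zb + 2³³·Zt·Zc + (ZA_a + ZA_b + ZA_c)`.  Remaining hypotheses (asks, by name): `IsUnit` of the partition
function at the NEW frame `(K_N, N)` (the old frame's follows: `TwoVolumeDefect.isUnit_effPartitionFn_frame_iff_lastScale`, k3c4-p2); the symbol sups `Dg_X, A₀_X` (order `Mg ≥ 8`; `…LastRespSymbolSups`); the moments of `σ_N[K_N]` and of the odd average (`…LastRespOddMoments`);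
the layer-A rows `AL_X` and the alias Bell rows `AA_X` (curve table explicit); the Bell rows `PP_b, PP_c` and the sizes `Zb, Zc, ZA_X`.

* **`lastResponse_bracket_flow_sharp`** (composition: `…ResponseBracketFlowSharpCore.lastResponse_bracket_flow_sharp_core`).

Composition only; no definitions; nothing asserts superconductivity.  Refs: BGM 2006 §2.2 (2.23), §2.4 Lemma 2.1 (2.36)–(2.42)
[cite: BenfattoGiulianiMastropietro2006]; FST 1996 §1 [cite: FeldmanSalmhoferTrubowitz1996].
-/

noncomputable section

namespace Summit.HubbardSuperconductivity.HubbardSuperconductivity.Theorems.EngineV8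

set_option linter.dupNamespace false -- summit = problem name (single-conjunct summit), D-0017

open Complex Real Finset Filter Literature.MathematicalPhysics.QuantumLattice Literature.Probability.LatticeModels
open Literature.MathematicalPhysics.QuantumLattice.BandSectorCounting
open Literature.Analysis.Fourier Literature.Analysis.Calculus
open Summit.HubbardSuperconductivity.HubbardSuperconductivity.Theorems.KLRegimeSplit
open Summit.HubbardSuperconductivity.HubbardSuperconductivity.Theorems.DispersionFlow
open Summit.HubbardSuperconductivity.HubbardSuperconductivity.Theorems.KLProgrammeLegKernels
open Summit.HubbardSuperconductivity.HubbardSuperconductivity.Theorems.PerturbedFermiCurve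

section FlowSharp

variable {L M : ℕ} [NeZero L] [NeZero M]

/-- **THE RESPONSE BRACKET AT THE FLOW FRAMES, SHARP CONSTANTS** — see the module docstring.  Output = `(hRdiff, hR)` of
`twoLegReadPriv_flow_succ_of_swap_lit` at `n = nScales β` with `eR = fun k => if k = 0 then 0 else 1`, `eR' = fun k => if k = 0 then 1 else 0`. -/
theorem lastResponse_bracket_flow_sharp {R : RenConsts} (hR : ∀ j, 0 ≤ R.Gfr j) {c : ℝ} (hc : 0 < c) (hcle : c ≤ klCurveC3 R)
    {U : ℝ} (hU : 0 < U) (hU1 : U ≤ 1) (hUle : U ≤ klCurveU0 R) {β : ℝ} (hβmin : klBetaMin ≤ β) (hβc : β ≤ Real.exp (c / U ^ 2))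
    {μ : ℝ} (hμ : μ ∈ klWindowC) (hK : FrameOK R U (nScales β) μ (klFlowFrameU L M β U μ (nScales β))) (hP : FlowPieceJetsAt L M β U μ R (nScales β))
    (hZn : IsUnit (effPartitionFn ℂ (normalCovariance L M (uvSymbolCT L M β μ (klFlowFrameU L M β U μ (nScales β + 1)) (klScale klE0 (nScales β + 1))))
      (hubbardInteraction L M β U + counterQuadratic L M β (klFlowFrameU L M β U μ (nScales β + 1)))))
    {Zt Zb Zc ZAa ZAb ZAc : ℝ} (hZt : 128 * (R.Gfr 0 + R.Gfr 1 + R.Gfr 2 + R.Gfr 3 + R.Gfr 4) * (1696963596321 + 925 * (10 ^ 14 * (1 + R.Gfr 3 + R.Gfr 4))) ≤ Zt) (hZtU : 2 * Zt * U ≤ 1)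
    (hCU : 16 * (2 ^ 29 * (1 / 32) * Zt ^ 3 * (1696963596321 + 925 * (10 ^ 14 * (1 + R.Gfr 3 + R.Gfr 4))) + 2 ^ 38 * Zt ^ 2 * Zb + 2 ^ 33 * Zt * Zc + (ZAa + ZAb + ZAc)) * U ≤ 1)
    {Mg : ℕ} (hMg : 8 ≤ Mg) {s : ℕ}
    {Dga : ℝ} (hDga : ∀ q, ‖iteratedFDeriv ℝ Mg (fun q : Momentum => ((((evalM (fsub (klFlowFrameU L M β U μ (nScales β)) (klFlowFrameU L M β U μ (nScales β + 1))) q * evalM (fsub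
        (klFlowFrameU L M β U μ (nScales β)) (klFlowFrameU L M β U μ (nScales β + 1))) q) / (β * (L : ℝ) ^ 2) : ℝ)) : ℂ) * (((uvWeightFn (klScale klE0 (nScales β + 1)) (matsubaraFreq β
        M (omega0 M)) (frameLevel μ (klFlowFrameU L M β U μ (nScales β)) q) : ℝ) : ℂ) * resolventFnXi (β * (L : ℝ) ^ 2) 0 (matsubaraFreq β M (omega0 M)) (frameLevel μ (klFlowFrameU L M
        β U μ (nScales β)) q + uvWeightFn (klScale klE0 (nScales β + 1)) (matsubaraFreq β M (omega0 M)) (frameLevel μ (klFlowFrameU L M β U μ (nScales β)) q) * evalM (fsub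
        (klFlowFrameU L M β U μ (nScales β)) (klFlowFrameU L M β U μ (nScales β + 1))) q))) q‖ ≤ Dga) {A₀a : ℝ} (hA₀a : ∀ q, ‖(fun q : Momentum => ((((evalM (fsub (klFlowFrameU L M β U
        μ (nScales β)) (klFlowFrameU L M β U μ (nScales β + 1))) q * evalM (fsub (klFlowFrameU L M β U μ (nScales β)) (klFlowFrameU L M β U μ (nScales β + 1))) q) / (β * (L : ℝ) ^ 2) :
        ℝ)) : ℂ) * (((uvWeightFn (klScale klE0 (nScales β + 1)) (matsubaraFreq β M (omega0 M)) (frameLevel μ (klFlowFrameU L M β U μ (nScales β)) q) : ℝ) : ℂ) * resolventFnXi (β * (L :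
        ℝ) ^ 2) 0 (matsubaraFreq β M (omega0 M)) (frameLevel μ (klFlowFrameU L M β U μ (nScales β)) q + uvWeightFn (klScale klE0 (nScales β + 1)) (matsubaraFreq β M (omega0 M))
        (frameLevel μ (klFlowFrameU L M β U μ (nScales β)) q) * evalM (fsub (klFlowFrameU L M β U μ (nScales β)) (klFlowFrameU L M β U μ (nScales β + 1))) q))) q‖ ≤ A₀a)
    {Dgb : ℝ} (hDgb : ∀ q, ‖iteratedFDeriv ℝ Mg (fun q : Momentum => ((((evalM (fsub (klFlowFrameU L M β U μ (nScales β)) (klFlowFrameU L M β U μ (nScales β + 1))) q / (β * (L : ℝ) ^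
        2) : ℝ)) : ℂ) * (((uvWeightFn (klScale klE0 (nScales β + 1)) (matsubaraFreq β M (omega0 M)) (frameLevel μ (klFlowFrameU L M β U μ (nScales β)) q) : ℝ) : ℂ) * resolventFnXi (β *
        (L : ℝ) ^ 2) 0 (matsubaraFreq β M (omega0 M)) (frameLevel μ (klFlowFrameU L M β U μ (nScales β)) q + uvWeightFn (klScale klE0 (nScales β + 1)) (matsubaraFreq β M (omega0 M))
        (frameLevel μ (klFlowFrameU L M β U μ (nScales β)) q) * evalM (fsub (klFlowFrameU L M β U μ (nScales β)) (klFlowFrameU L M β U μ (nScales β + 1))) q))) * ((((evalM (fsub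
        (klFlowFrameU L M β U μ (nScales β)) (klFlowFrameU L M β U μ (nScales β + 1))) q / (β * (L : ℝ) ^ 2) : ℝ)) : ℂ) * (((uvWeightFn (klScale klE0 (nScales β + 1)) (matsubaraFreq β
        M (omega0 M)) (frameLevel μ (klFlowFrameU L M β U μ (nScales β)) q) : ℝ) : ℂ) * resolventFnXi (β * (L : ℝ) ^ 2) 0 (matsubaraFreq β M (omega0 M)) (frameLevel μ (klFlowFrameU L M
        β U μ (nScales β)) q + uvWeightFn (klScale klE0 (nScales β + 1)) (matsubaraFreq β M (omega0 M)) (frameLevel μ (klFlowFrameU L M β U μ (nScales β)) q) * evalM (fsub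
        (klFlowFrameU L M β U μ (nScales β)) (klFlowFrameU L M β U μ (nScales β + 1))) q))) - (2 : ℂ) * ((((evalM (fsub (klFlowFrameU L M β U μ (nScales β)) (klFlowFrameU L M β U μ
        (nScales β + 1))) q / (β * (L : ℝ) ^ 2) : ℝ)) : ℂ) * (((uvWeightFn (klScale klE0 (nScales β + 1)) (matsubaraFreq β M (omega0 M)) (frameLevel μ (klFlowFrameU L M β U μ (nScales
        β)) q) : ℝ) : ℂ) * resolventFnXi (β * (L : ℝ) ^ 2) 0 (matsubaraFreq β M (omega0 M)) (frameLevel μ (klFlowFrameU L M β U μ (nScales β)) q + uvWeightFn (klScale klE0 (nScales β +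
        1)) (matsubaraFreq β M (omega0 M)) (frameLevel μ (klFlowFrameU L M β U μ (nScales β)) q) * evalM (fsub (klFlowFrameU L M β U μ (nScales β)) (klFlowFrameU L M β U μ (nScales β +
        1))) q)))) q‖ ≤ Dgb) {A₀b : ℝ} (hA₀b : ∀ q, ‖(fun q : Momentum => ((((evalM (fsub (klFlowFrameU L M β U μ (nScales β)) (klFlowFrameU L M β U μ (nScales β + 1))) q / (β * (L :
        ℝ) ^ 2) : ℝ)) : ℂ) * (((uvWeightFn (klScale klE0 (nScales β + 1)) (matsubaraFreq β M (omega0 M)) (frameLevel μ (klFlowFrameU L M β U μ (nScales β)) q) : ℝ) : ℂ) * resolventFnXi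
        (β * (L : ℝ) ^ 2) 0 (matsubaraFreq β M (omega0 M)) (frameLevel μ (klFlowFrameU L M β U μ (nScales β)) q + uvWeightFn (klScale klE0 (nScales β + 1)) (matsubaraFreq β M (omega0
        M)) (frameLevel μ (klFlowFrameU L M β U μ (nScales β)) q) * evalM (fsub (klFlowFrameU L M β U μ (nScales β)) (klFlowFrameU L M β U μ (nScales β + 1))) q))) * ((((evalM (fsub
        (klFlowFrameU L M β U μ (nScales β)) (klFlowFrameU L M β U μ (nScales β + 1))) q / (β * (L : ℝ) ^ 2) : ℝ)) : ℂ) * (((uvWeightFn (klScale klE0 (nScales β + 1)) (matsubaraFreq β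
        M (omega0 M)) (frameLevel μ (klFlowFrameU L M β U μ (nScales β)) q) : ℝ) : ℂ) * resolventFnXi (β * (L : ℝ) ^ 2) 0 (matsubaraFreq β M (omega0 M)) (frameLevel μ (klFlowFrameU L M
        β U μ (nScales β)) q + uvWeightFn (klScale klE0 (nScales β + 1)) (matsubaraFreq β M (omega0 M)) (frameLevel μ (klFlowFrameU L M β U μ (nScales β)) q) * evalM (fsub
        (klFlowFrameU L M β U μ (nScales β)) (klFlowFrameU L M β U μ (nScales β + 1))) q))) - (2 : ℂ) * ((((evalM (fsub (klFlowFrameU L M β U μ (nScales β)) (klFlowFrameU L M β U μ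
        (nScales β + 1))) q / (β * (L : ℝ) ^ 2) : ℝ)) : ℂ) * (((uvWeightFn (klScale klE0 (nScales β + 1)) (matsubaraFreq β M (omega0 M)) (frameLevel μ (klFlowFrameU L M β U μ (nScales
        β)) q) : ℝ) : ℂ) * resolventFnXi (β * (L : ℝ) ^ 2) 0 (matsubaraFreq β M (omega0 M)) (frameLevel μ (klFlowFrameU L M β U μ (nScales β)) q + uvWeightFn (klScale klE0 (nScales β +
        1)) (matsubaraFreq β M (omega0 M)) (frameLevel μ (klFlowFrameU L M β U μ (nScales β)) q) * evalM (fsub (klFlowFrameU L M β U μ (nScales β)) (klFlowFrameU L M β U μ (nScales β +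
        1))) q)))) q‖ ≤ A₀b)
    {Mmb : ℕ → ℝ} (hMmb : ∀ m ≤ 4, ∑ x : TorusSite 2 L, (1 + ((x 0).valMinAbs.natAbs : ℝ) + ((x 1).valMinAbs.natAbs : ℝ)) ^ m *
      ‖torusFourierInv (fun k => ((((fun k : TorusSite 2 L => klLocSelfEnergyRe L M β U μ (klFlowFrameU L M β U μ (nScales β + 1)) (nScales β + 1) k) k : ℝ)) : ℂ)) x‖ ≤ Mmb m)
    {Msb : ℝ} (hMsb : ∑ x : TorusSite 2 L, (1 + ((x 0).valMinAbs.natAbs : ℝ) + ((x 1).valMinAbs.natAbs : ℝ)) ^ s *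
      ‖torusFourierInv (fun k => ((((fun k : TorusSite 2 L => klLocSelfEnergyRe L M β U μ (klFlowFrameU L M β U μ (nScales β + 1)) (nScales β + 1) k) k : ℝ)) : ℂ)) x‖ ≤ Msb)
    {Dgc : ℝ} (hDgc : ∀ q, ‖iteratedFDeriv ℝ Mg (fun q : Momentum => -I * (((((evalM (fsub (klFlowFrameU L M β U μ (nScales β)) (klFlowFrameU L M β U μ (nScales β + 1))) q / (β * (L :
        ℝ) ^ 2) : ℝ)) : ℂ) * (((uvWeightFn (klScale klE0 (nScales β + 1)) (matsubaraFreq β M (omega0 M)) (frameLevel μ (klFlowFrameU L M β U μ (nScales β)) q) : ℝ) : ℂ) * resolventFnXi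
        (β * (L : ℝ) ^ 2) 0 (matsubaraFreq β M (omega0 M)) (frameLevel μ (klFlowFrameU L M β U μ (nScales β)) q + uvWeightFn (klScale klE0 (nScales β + 1)) (matsubaraFreq β M (omega0
        M)) (frameLevel μ (klFlowFrameU L M β U μ (nScales β)) q) * evalM (fsub (klFlowFrameU L M β U μ (nScales β)) (klFlowFrameU L M β U μ (nScales β + 1))) q))) * ((((evalM (fsub
        (klFlowFrameU L M β U μ (nScales β)) (klFlowFrameU L M β U μ (nScales β + 1))) q / (β * (L : ℝ) ^ 2) : ℝ)) : ℂ) * (((uvWeightFn (klScale klE0 (nScales β + 1)) (matsubaraFreq β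
        M (omega0 M)) (frameLevel μ (klFlowFrameU L M β U μ (nScales β)) q) : ℝ) : ℂ) * resolventFnXi (β * (L : ℝ) ^ 2) 0 (matsubaraFreq β M (omega0 M)) (frameLevel μ (klFlowFrameU L M
        β U μ (nScales β)) q + uvWeightFn (klScale klE0 (nScales β + 1)) (matsubaraFreq β M (omega0 M)) (frameLevel μ (klFlowFrameU L M β U μ (nScales β)) q) * evalM (fsub
        (klFlowFrameU L M β U μ (nScales β)) (klFlowFrameU L M β U μ (nScales β + 1))) q))) - (2 : ℂ) * ((((evalM (fsub (klFlowFrameU L M β U μ (nScales β)) (klFlowFrameU L M β U μ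
        (nScales β + 1))) q / (β * (L : ℝ) ^ 2) : ℝ)) : ℂ) * (((uvWeightFn (klScale klE0 (nScales β + 1)) (matsubaraFreq β M (omega0 M)) (frameLevel μ (klFlowFrameU L M β U μ (nScales
        β)) q) : ℝ) : ℂ) * resolventFnXi (β * (L : ℝ) ^ 2) 0 (matsubaraFreq β M (omega0 M)) (frameLevel μ (klFlowFrameU L M β U μ (nScales β)) q + uvWeightFn (klScale klE0 (nScales β +
        1)) (matsubaraFreq β M (omega0 M)) (frameLevel μ (klFlowFrameU L M β U μ (nScales β)) q) * evalM (fsub (klFlowFrameU L M β U μ (nScales β)) (klFlowFrameU L M β U μ (nScales β +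
        1))) q))))) q‖ ≤ Dgc) {A₀c : ℝ} (hA₀c : ∀ q, ‖(fun q : Momentum => -I * (((((evalM (fsub (klFlowFrameU L M β U μ (nScales β)) (klFlowFrameU L M β U μ (nScales β + 1))) q / (β *
        (L : ℝ) ^ 2) : ℝ)) : ℂ) * (((uvWeightFn (klScale klE0 (nScales β + 1)) (matsubaraFreq β M (omega0 M)) (frameLevel μ (klFlowFrameU L M β U μ (nScales β)) q) : ℝ) : ℂ) *
        resolventFnXi (β * (L : ℝ) ^ 2) 0 (matsubaraFreq β M (omega0 M)) (frameLevel μ (klFlowFrameU L M β U μ (nScales β)) q + uvWeightFn (klScale klE0 (nScales β + 1)) (matsubaraFreq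
        β M (omega0 M)) (frameLevel μ (klFlowFrameU L M β U μ (nScales β)) q) * evalM (fsub (klFlowFrameU L M β U μ (nScales β)) (klFlowFrameU L M β U μ (nScales β + 1))) q))) *
        ((((evalM (fsub (klFlowFrameU L M β U μ (nScales β)) (klFlowFrameU L M β U μ (nScales β + 1))) q / (β * (L : ℝ) ^ 2) : ℝ)) : ℂ) * (((uvWeightFn (klScale klE0 (nScales β + 1))
        (matsubaraFreq β M (omega0 M)) (frameLevel μ (klFlowFrameU L M β U μ (nScales β)) q) : ℝ) : ℂ) * resolventFnXi (β * (L : ℝ) ^ 2) 0 (matsubaraFreq β M (omega0 M)) (frameLevel μ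
        (klFlowFrameU L M β U μ (nScales β)) q + uvWeightFn (klScale klE0 (nScales β + 1)) (matsubaraFreq β M (omega0 M)) (frameLevel μ (klFlowFrameU L M β U μ (nScales β)) q) * evalM
        (fsub (klFlowFrameU L M β U μ (nScales β)) (klFlowFrameU L M β U μ (nScales β + 1))) q))) - (2 : ℂ) * ((((evalM (fsub (klFlowFrameU L M β U μ (nScales β)) (klFlowFrameU L M β U
        μ (nScales β + 1))) q / (β * (L : ℝ) ^ 2) : ℝ)) : ℂ) * (((uvWeightFn (klScale klE0 (nScales β + 1)) (matsubaraFreq β M (omega0 M)) (frameLevel μ (klFlowFrameU L M β U μ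
        (nScales β)) q) : ℝ) : ℂ) * resolventFnXi (β * (L : ℝ) ^ 2) 0 (matsubaraFreq β M (omega0 M)) (frameLevel μ (klFlowFrameU L M β U μ (nScales β)) q + uvWeightFn (klScale klE0
        (nScales β + 1)) (matsubaraFreq β M (omega0 M)) (frameLevel μ (klFlowFrameU L M β U μ (nScales β)) q) * evalM (fsub (klFlowFrameU L M β U μ (nScales β)) (klFlowFrameU L M β U μ
        (nScales β + 1))) q))))) q‖ ≤ A₀c)
    {Mmc : ℕ → ℝ} (hMmc : ∀ m ≤ 4, ∑ x : TorusSite 2 L, (1 + ((x 0).valMinAbs.natAbs : ℝ) + ((x 1).valMinAbs.natAbs : ℝ)) ^ m *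
      ‖torusFourierInv (fun k => ((((fun k : TorusSite 2 L => (∑ s : Fin 2, ((klSelfEnergy L M β U μ (klFlowFrameU L M β U μ (nScales β + 1)) klE0 (nScales β + 1) (omega0 M, k) s).im -
          (klSelfEnergy L M β U μ (klFlowFrameU L M β U μ (nScales β + 1)) klE0 (nScales β + 1) ((omega0 M).rev, k) s).im)) / 4) k : ℝ)) : ℂ)) x‖ ≤ Mmc m)
    {Msc : ℝ} (hMsc : ∑ x : TorusSite 2 L, (1 + ((x 0).valMinAbs.natAbs : ℝ) + ((x 1).valMinAbs.natAbs : ℝ)) ^ s *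
      ‖torusFourierInv (fun k => ((((fun k : TorusSite 2 L => (∑ s : Fin 2, ((klSelfEnergy L M β U μ (klFlowFrameU L M β U μ (nScales β + 1)) klE0 (nScales β + 1) (omega0 M, k) s).im -
          (klSelfEnergy L M β U μ (klFlowFrameU L M β U μ (nScales β + 1)) klE0 (nScales β + 1) ((omega0 M).rev, k) s).im)) / 4) k : ℝ)) : ℂ)) x‖ ≤ Msc)
    {ALa : ℕ → ℝ}
    (hALa : ∀ j ≤ 4, 2 * (2 * (1 * ((3 : ℝ) ^ j * Dga * (2 / ((2 * (L / 4 + 1) : ℕ) : ℝ)) ^ (Mg - j - 4) *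
        (2 ^ 2 * ∑' k : Fin 2 → ℤ, ∏ i, (1 + (k i : ℝ) ^ 2)⁻¹)))) + (L : ℝ) ^ 2 * (L : ℝ) ^ j * (A₀a * (1 / (1 + (L : ℝ) / 4) ^ s)) ≤ ALa j)
    {AAa : ℕ → ℝ} (hAAa0 : ALa 0 ≤ AAa 0) (hAAa1 : ALa 1 * klCurveD1 ≤ AAa 1) (hAAa2 : ALa 2 * klCurveD1 ^ 2 + ALa 1 * klCurveD2 ≤ AAa 2)
    (hAAa3 : ALa 3 * klCurveD1 ^ 3 + 3 * ALa 2 * klCurveD1 * klCurveD2 + ALa 1 * (klCurveD3 (R.Gfr 3 * U ^ 2 * ((4 : ℝ) ^ (nScales β + 1) / 3))) ≤ AAa 3)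
    (hAAa4 : ALa 4 * klCurveD1 ^ 4 + 6 * ALa 3 * klCurveD1 ^ 2 * klCurveD2 + 3 * ALa 2 * klCurveD2 ^ 2 + 4 * ALa 2 * klCurveD1 * (klCurveD3 (R.Gfr 3 * U ^ 2 * ((4 : ℝ) ^ (nScales β +
        1) / 3))) + ALa 1 * (klCurveD4 (R.Gfr 3 * U ^ 2 * ((4 : ℝ) ^ (nScales β + 1) / 3)) (R.Gfr 4 * U ^ 2 * ((16 : ℝ) ^ (nScales β + 1) / 15))) ≤ AAa 4)
    {ALb : ℕ → ℝ}
    (hALb : ∀ j ≤ 4, 2 * (2 * (Mmb j * ((3 : ℝ) ^ j * Dgb * (2 / ((2 * (L / 4 + 1) : ℕ) : ℝ)) ^ (Mg - j - 4) *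
        (2 ^ 2 * ∑' k : Fin 2 → ℤ, ∏ i, (1 + (k i : ℝ) ^ 2)⁻¹)))) + (L : ℝ) ^ 2 * (L : ℝ) ^ j * (A₀b * (Msb / (1 + (L : ℝ) / 4) ^ s)) ≤ ALb j)
    {PPb : ℕ → ℝ} (hPPb0 : Mmb 0 ≤ PPb 0) (hPPb1 : Mmb 1 * klCurveD1 ≤ PPb 1) (hPPb2 : Mmb 2 * klCurveD1 ^ 2 + Mmb 1 * klCurveD2 ≤ PPb 2)
    (hPPb3 : Mmb 3 * klCurveD1 ^ 3 + 3 * Mmb 2 * klCurveD1 * klCurveD2 + Mmb 1 * (klCurveD3 (R.Gfr 3 * U ^ 2 * ((4 : ℝ) ^ (nScales β + 1) / 3))) ≤ PPb 3)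
    (hPPb4 : Mmb 4 * klCurveD1 ^ 4 + 6 * Mmb 3 * klCurveD1 ^ 2 * klCurveD2 + 3 * Mmb 2 * klCurveD2 ^ 2 + 4 * Mmb 2 * klCurveD1 * (klCurveD3 (R.Gfr 3 * U ^ 2 * ((4 : ℝ) ^ (nScales β +
        1) / 3))) + Mmb 1 * (klCurveD4 (R.Gfr 3 * U ^ 2 * ((4 : ℝ) ^ (nScales β + 1) / 3)) (R.Gfr 4 * U ^ 2 * ((16 : ℝ) ^ (nScales β + 1) / 15))) ≤ PPb 4)
    {AAb : ℕ → ℝ} (hAAb0 : ALb 0 ≤ AAb 0) (hAAb1 : ALb 1 * klCurveD1 ≤ AAb 1) (hAAb2 : ALb 2 * klCurveD1 ^ 2 + ALb 1 * klCurveD2 ≤ AAb 2)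
    (hAAb3 : ALb 3 * klCurveD1 ^ 3 + 3 * ALb 2 * klCurveD1 * klCurveD2 + ALb 1 * (klCurveD3 (R.Gfr 3 * U ^ 2 * ((4 : ℝ) ^ (nScales β + 1) / 3))) ≤ AAb 3)
    (hAAb4 : ALb 4 * klCurveD1 ^ 4 + 6 * ALb 3 * klCurveD1 ^ 2 * klCurveD2 + 3 * ALb 2 * klCurveD2 ^ 2 + 4 * ALb 2 * klCurveD1 * (klCurveD3 (R.Gfr 3 * U ^ 2 * ((4 : ℝ) ^ (nScales β +
        1) / 3))) + ALb 1 * (klCurveD4 (R.Gfr 3 * U ^ 2 * ((4 : ℝ) ^ (nScales β + 1) / 3)) (R.Gfr 4 * U ^ 2 * ((16 : ℝ) ^ (nScales β + 1) / 15))) ≤ AAb 4)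
    {ALc : ℕ → ℝ}
    (hALc : ∀ j ≤ 4, 2 * (2 * (Mmc j * ((3 : ℝ) ^ j * Dgc * (2 / ((2 * (L / 4 + 1) : ℕ) : ℝ)) ^ (Mg - j - 4) *
        (2 ^ 2 * ∑' k : Fin 2 → ℤ, ∏ i, (1 + (k i : ℝ) ^ 2)⁻¹)))) + (L : ℝ) ^ 2 * (L : ℝ) ^ j * (A₀c * (Msc / (1 + (L : ℝ) / 4) ^ s)) ≤ ALc j)
    {PPc : ℕ → ℝ} (hPPc0 : Mmc 0 ≤ PPc 0) (hPPc1 : Mmc 1 * klCurveD1 ≤ PPc 1) (hPPc2 : Mmc 2 * klCurveD1 ^ 2 + Mmc 1 * klCurveD2 ≤ PPc 2)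
    (hPPc3 : Mmc 3 * klCurveD1 ^ 3 + 3 * Mmc 2 * klCurveD1 * klCurveD2 + Mmc 1 * (klCurveD3 (R.Gfr 3 * U ^ 2 * ((4 : ℝ) ^ (nScales β + 1) / 3))) ≤ PPc 3)
    (hPPc4 : Mmc 4 * klCurveD1 ^ 4 + 6 * Mmc 3 * klCurveD1 ^ 2 * klCurveD2 + 3 * Mmc 2 * klCurveD2 ^ 2 + 4 * Mmc 2 * klCurveD1 * (klCurveD3 (R.Gfr 3 * U ^ 2 * ((4 : ℝ) ^ (nScales β +
        1) / 3))) + Mmc 1 * (klCurveD4 (R.Gfr 3 * U ^ 2 * ((4 : ℝ) ^ (nScales β + 1) / 3)) (R.Gfr 4 * U ^ 2 * ((16 : ℝ) ^ (nScales β + 1) / 15))) ≤ PPc 4)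
    {AAc : ℕ → ℝ} (hAAc0 : ALc 0 ≤ AAc 0) (hAAc1 : ALc 1 * klCurveD1 ≤ AAc 1) (hAAc2 : ALc 2 * klCurveD1 ^ 2 + ALc 1 * klCurveD2 ≤ AAc 2)
    (hAAc3 : ALc 3 * klCurveD1 ^ 3 + 3 * ALc 2 * klCurveD1 * klCurveD2 + ALc 1 * (klCurveD3 (R.Gfr 3 * U ^ 2 * ((4 : ℝ) ^ (nScales β + 1) / 3))) ≤ AAc 3)
    (hAAc4 : ALc 4 * klCurveD1 ^ 4 + 6 * ALc 3 * klCurveD1 ^ 2 * klCurveD2 + 3 * ALc 2 * klCurveD2 ^ 2 + 4 * ALc 2 * klCurveD1 * (klCurveD3 (R.Gfr 3 * U ^ 2 * ((4 : ℝ) ^ (nScales β +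
        1) / 3))) + ALc 1 * (klCurveD4 (R.Gfr 3 * U ^ 2 * ((4 : ℝ) ^ (nScales β + 1) / 3)) (R.Gfr 4 * U ^ 2 * ((16 : ℝ) ^ (nScales β + 1) / 15))) ≤ AAc 4)
    (hPPbs : ∀ j ≤ 4, PPb j ≤ Zb * U * ((4 : ℝ) ^ nScales β) ^ j)
    (hPPcs : ∀ j ≤ 4, PPc j ≤ Zc * U ^ 2 * ((4 : ℝ) ^ nScales β) ^ j / ((4 : ℝ) ^ nScales β))
    (hAAas : ∀ k ≤ 4, AAa k ≤ ZAa * U ^ 3 * ((4 : ℝ) ^ nScales β) ^ k / ((4 : ℝ) ^ nScales β) ^ 2) (hAAbs : ∀ k ≤ 4, AAb k ≤ ZAb * U ^ 3 * ((4 : ℝ) ^ nScales β) ^ k / ((4 : ℝ) ^ nScales β) ^ 2)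
    (hAAcs : ∀ k ≤ 4, AAc k ≤ ZAc * U ^ 3 * ((4 : ℝ) ^ nScales β) ^ k / ((4 : ℝ) ^ nScales β) ^ 2) :
    ContDiff ℝ 4 (fun θ : ℝ => (symInterp L (fun k => klLocSelfEnergyRe L M β U μ (klFlowFrameU L M β U μ (nScales β + 1)) (nScales β + 1) k -
            (klFlowFrameU L M β U μ (nScales β + 1)).eval (latticeMomentum L k))).eval (klFermiPoint μ (klFlowFrameU L M β U μ (nScales β)) θ) -
        (symInterp L (fun k => klLocSelfEnergyRe L M β U μ (klFlowFrameU L M β U μ (nScales β)) (nScales β + 1) k -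
            (klFlowFrameU L M β U μ (nScales β)).eval (latticeMomentum L k))).eval (klFermiPoint μ (klFlowFrameU L M β U μ (nScales β)) θ)) ∧
    ∀ k ≤ 4, ∀ θ : ℝ, |iteratedDeriv k (fun θ : ℝ => (symInterp L (fun k => klLocSelfEnergyRe L M β U μ (klFlowFrameU L M β U μ (nScales β + 1)) (nScales β + 1) k -
            (klFlowFrameU L M β U μ (nScales β + 1)).eval (latticeMomentum L k))).eval (klFermiPoint μ (klFlowFrameU L M β U μ (nScales β)) θ) -
        (symInterp L (fun k => klLocSelfEnergyRe L M β U μ (klFlowFrameU L M β U μ (nScales β)) (nScales β + 1) k -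
            (klFlowFrameU L M β U μ (nScales β)).eval (latticeMomentum L k))).eval (klFermiPoint μ (klFlowFrameU L M β U μ (nScales β)) θ)) θ| ≤
      curveJetBar (fun k => if k = 0 then 0 else 1) (fun k => if k = 0 then 1 else 0) U k (nScales β + 1) := by
  have hβ0 : 0 < β := KLRegimeSplit.pos_of_klBetaMin_le hβmin
  -- below temperature the partition function is a unit at the old frame iff at the new one
  have hZo := (TwoVolumeDefect.isUnit_effPartitionFn_frame_iff_lastScale (L := L) (M := M) hβ0 U μ (klFlowFrameU L M β U μ (nScales β)) (klFlowFrameU L M β U μ (nScales β + 1))).1 hZn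
  -- the curve of the old flow frame
  obtain ⟨hAf, hA20, -, hd, ⟨hlo, hhi⟩, hA₃, hA₄⟩ := frame_sizes_of_frameOK_explicit hR hc hcle hU hUle hβmin hβc hμ hK
  have hcv := fun θ : ℝ => fermiPointLp_sizes_of_sizes hAf hA20 hd hlo hhi hA₃ hA₄ θ
  have hγ : ContDiff ℝ 4 (fun θ : ℝ => (WithLp.toLp 2 (klFermiPoint μ (klFlowFrameU L M β U μ (nScales β)) θ) : Momentum)) := (hcv 0).1
  have hDc : ∀ θ : ℝ, ∀ i, 1 ≤ i → i ≤ 4 → ‖iteratedDeriv i (fun θ : ℝ => (WithLp.toLp 2 (klFermiPoint μ (klFlowFrameU L M β U μ (nScales β)) θ) : Momentum)) θ‖ ≤ (fun i : ℕ => if i =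
      1 then klCurveD1 else if i = 2 then klCurveD2 else if i = 3 then klCurveD3 (R.Gfr 3 * U ^ 2 * ((4 : ℝ) ^ (nScales β + 1) / 3)) else klCurveD4 (R.Gfr 3 * U ^ 2 * ((4 : ℝ) ^
      (nScales β + 1) / 3)) (R.Gfr 4 * U ^ 2 * ((16 : ℝ) ^ (nScales β + 1) / 15))) i := by
    intro θ i hi1 hi4
    obtain ⟨-, g1, g2, g3, g4⟩ := hcv θ
    rw [← norm_iteratedFDeriv_eq_norm_iteratedDeriv]
    interval_cases i
    · exact g1
    · exact g2
    · exact g3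
    · exact g4
  have hcurve : ∀ θ : ℝ, frameLevel μ (klFlowFrameU L M β U μ (nScales β)) ((fun θ : ℝ => (WithLp.toLp 2 (klFermiPoint μ (klFlowFrameU L M β U μ (nScales β)) θ) : Momentum)) θ) = 0 := fun θ =>
    frameLevel_klFermiPoint (bandBounds (show (-4 : ℝ) < -1.1 by norm_num) (show (-1.1 : ℝ) ≤ -0.1 by norm_num) (show (-0.1 : ℝ) < 0 by norm_num))
      hAf hlo hhi θ
  -- the sharp table and the tangential jets of the last piece
  obtain ⟨hD1, hDc1, hDc2, hDc3, hDc4⟩ := flowCurve_table_sharp hR hU.le hU1 (nScales β)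
  have hG5 : ∀ j ≤ 4, R.Gfr j ≤ (R.Gfr 0 + R.Gfr 1 + R.Gfr 2 + R.Gfr 3 + R.Gfr 4) := by
    intro j hj
    have := hR 0; have := hR 1; have := hR 2; have := hR 3; have := hR 4
    interval_cases j <;> linarith
  have eP : ((231 : ℝ) ^ 4 + 6 * 231 ^ 2 * 700000 + 3 * 700000 ^ 2 + 4 * 231 * (10 ^ 14 * (1 + R.Gfr 3 + R.Gfr 4)) + (10 ^ 14 * (1 + R.Gfr 3 + R.Gfr 4))) = (1696963596321 + 925 * (10 ^
      14 * (1 + R.Gfr 3 + R.Gfr 4))) := by ring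
  have hZt' : 128 * (R.Gfr 0 + R.Gfr 1 + R.Gfr 2 + R.Gfr 3 + R.Gfr 4) * ((231 : ℝ) ^ 4 + 6 * 231 ^ 2 * 700000 + 3 * 700000 ^ 2 + 4 * 231 * (10 ^ 14 * (1 + R.Gfr 3 + R.Gfr 4)) + (10 ^
      14 * (1 + R.Gfr 3 + R.Gfr 4))) ≤ Zt := by rw [eP]; exact hZt
  obtain ⟨ht0, htd⟩ := lastResponse_tjets_of_pieceJets_sharp hβ0 (Nat.lt_succ_self _) hU hU1 (klFlowFrameU L M β U μ (nScales β)) (klFlowPiece L M β U μ (nScales β))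
    (fun j hj => hR j) hG5 hP hγ hDc (by norm_num) (by norm_num) hD1 hDc1 hDc2 hDc3 hDc4 hZt'
  rw [← klFlowFrameU_succ] at ht0 htd
  have hZt0 : 0 ≤ Zt := le_trans (by have := hR 0; have := hR 1; have := hR 2; have := hR 3; have := hR 4; positivity) hZt
  -- the frequency window and the datum-`1` rows
  have hω := pi_div_le_Z_div_four_pow_nScales hβmin (le_refl (1 / 32 : ℝ))
  obtain ⟨r0, r1, r2, r3, r4⟩ := datumOne_rows_flow hR hU.le hU1 β
  exact lastResponse_bracket_flow_sharp_core hβ0 hU μ hZn hZo hZt0 hZtU hCU hγ hcurve hDc hω ht0 htd r0 r1 r2 r3 r4 hMg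
    hDga hA₀a hDgb hA₀b hMmb hMsb hDgc hA₀c hMmc hMsc hALa hAAa0 hAAa1 hAAa2 hAAa3 hAAa4
    hALb hPPb0 hPPb1 hPPb2 hPPb3 hPPb4 hAAb0 hAAb1 hAAb2 hAAb3 hAAb4
    hALc hPPc0 hPPc1 hPPc2 hPPc3 hPPc4 hAAc0 hAAc1 hAAc2 hAAc3 hAAc4 hPPbs hPPcs hAAas hAAbs hAAcs

end FlowSharp

end Summit.HubbardSuperconductivity.HubbardSuperconductivity.Theorems.EngineV8

end
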